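import Summits.CriticalPhenomena.PercolationContinuityZ3.Theorems.PercNearOneGluingNoHeavyLowerTailSahiHittingCoreTrace
import Summits.CriticalPhenomena.PercolationContinuityZ3.Theorems.PercNearOneGluingNoHeavyLowerTailSahiHittingWidthFour
import HarnessLib

/-!
# `NoHeavyLowerTail` (stmt-CriticalPhenomena-4575) — hitting families at every order: TRACE WIDTH ≤ 4 (computational twin)

Support file, seat `prim-l12-p5` (gen 8), `--supports stmt-CriticalPhenomena-4575`.  No definitions, no named facts, no sorries.  Computational
axioms are inherited from the kernel certificate of the hitting `C₄` (`…SahiE4HittingEvents`, via `…SahiHittingWidthFour`); the standard-axiom part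
(the core-trace reduction and trace width ≤ 3) is the companion file `…SahiHittingCoreTrace`.

* **`prodBernoulli_sahiE_hit_nonneg_of_core_width_le_four`**: `A_l ⊇ K_l` with private differences (a coin of `A_l ∖ K_l` lies in no other
  `A_{l'}`); if among any FIVE indices two carry nested traces `K_i ⊆ K_j`, then `E_m(1_{H_{A_0}},…,1_{H_{A_{m−1}}}) ≥ 0` for every product
  weight and every `m`.  Corollary `…_of_four_traces`: traces taking at most four distinct values, arbitrary multiplicities and petals.
* `prodBernoulli_sahiE_hit_nonneg_of_core_width_le` — LOCALITY, trace form: Sahi's `C_1,…,C_k` for hitting families ⟹ every order for hitting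
  families whose traces on the shared coins have width ≤ `k`.
So the open part of Sahi positivity for hitting events ("Q-OR") is: families in which every coin is shared by at least two sets AND of width ≥ 5.
-/

noncomputable section

open scoped Classical

namespace Summit.CriticalPhenomena.PercolationContinuityZ3.Theorems

namespace SahiHitting

open Finset Function Literature.Combinatorics.Sahi2008 SahiMomentExpansion SahiHereditaryMeetAbsorption
open Literature.Probability.Percolation.DecisionTree (ind ind_of_mem ind_of_not_mem ind_nonneg)

variable {ι : Type} [Fintype ι]

omit [Fintype ι] in
/-- Transport of a "two nested among any `k+1`" hypothesis to a sub-family in increasing enumeration. [folklore] -/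
theorem nested_of_subfamily {m k : ℕ} (K : Fin m → Finset ι)
    (hw : ∀ S : Finset (Fin m), S.card = k + 1 → ∃ i ∈ S, ∃ j ∈ S, i ≠ j ∧ K i ⊆ K j) (S : Finset (Fin m))
    (T : Finset (Fin S.card)) (hT : T.card = k + 1) :
    ∃ i ∈ T, ∃ j ∈ T, i ≠ j ∧ K (S.orderEmbOfFin rfl i) ⊆ K (S.orderEmbOfFin rfl j) := by
  set f : Fin S.card ↪o Fin m := S.orderEmbOfFin rfl
  obtain ⟨i, hi, j, hj, hij, hsub⟩ := hw (T.map f.toEmbedding) (by rw [Finset.card_map]; exact hT)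
  obtain ⟨i', hi', rfl⟩ := Finset.mem_map.mp hi
  obtain ⟨j', hj', rfl⟩ := Finset.mem_map.mp hj
  exact ⟨i', hi', j', hj', fun h => hij (by rw [h]), hsub⟩

/-- **Every order for hitting families whose TRACES have width ≤ 4** (computational).  `A_l ⊇ K_l` with private differences; if among any
five indices two carry nested traces, then `E_m(1_{H_{A_0}},…,1_{H_{A_{m−1}}}) ≥ 0`. [this work] -/
theorem prodBernoulli_sahiE_hit_nonneg_of_core_width_le_four (p : ι → unitInterval) (m : ℕ) (A K : Fin m → Finset ι)
    (hKA : ∀ l, K l ⊆ A l) (hpriv : ∀ l, ∀ a ∈ A l, a ∉ K l → ∀ l', l' ≠ l → a ∉ A l')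
    (hw : ∀ S : Finset (Fin m), S.card = 5 → ∃ i ∈ S, ∃ j ∈ S, i ≠ j ∧ K i ⊆ K j) :
    0 ≤ sahiE (bernoulliWeight p) m (fun l => ind {ω : Set ι | ∃ a ∈ A l, a ∈ ω}) :=
  prodBernoulli_sahiE_hit_nonneg_of_core p m A K hKA hpriv fun S _ =>
    prodBernoulli_sahiE_hit_nonneg_of_width_le_four p S.card (fun j => K (S.orderEmbOfFin rfl j)) (nested_of_subfamily K hw S)

/-- **At most four distinct traces, arbitrary multiplicities and petals, every order** (computational). [this work] -/
theorem prodBernoulli_sahiE_hit_nonneg_of_four_traces (p : ι → unitInterval) (C : Fin 4 → Finset ι) (m : ℕ) (c : Fin m → Fin 4)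
    (A : Fin m → Finset ι) (hCA : ∀ l, C (c l) ⊆ A l) (hpriv : ∀ l, ∀ a ∈ A l, a ∉ C (c l) → ∀ l', l' ≠ l → a ∉ A l') :
    0 ≤ sahiE (bernoulliWeight p) m (fun l => ind {ω : Set ι | ∃ a ∈ A l, a ∈ ω}) := by
  refine prodBernoulli_sahiE_hit_nonneg_of_core_width_le_four p m A (fun l => C (c l)) hCA hpriv fun S hS => ?_
  have hlt : (Finset.univ : Finset (Fin 4)).card < S.card := by simp [hS]
  obtain ⟨i, hi, j, hj, hij, hc⟩ := Finset.exists_ne_map_eq_of_card_lt_of_maps_to hlt (f := c) fun _ _ => Finset.mem_univ _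
  exact ⟨i, hi, j, hj, hij, by simp [hc]⟩

/-- **Locality, trace form.**  If Sahi positivity holds for ALL hitting families with at most `k` slots on `2^ι` (`k ≥ 1`), then it holds at
every order for hitting families whose traces on the shared coins have width ≤ `k` (among any `k+1` indices two nested traces), with arbitrary
private petals. [this work] -/
theorem prodBernoulli_sahiE_hit_nonneg_of_core_width_le (p : ι → unitInterval) {k : ℕ} (hk : 1 ≤ k)
    (hC : ∀ (n : ℕ), n ≤ k → ∀ B : Fin n → Finset ι, 0 ≤ sahiE (bernoulliWeight p) n (fun l => ind {ω : Set ι | ∃ a ∈ B l, a ∈ ω}))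
    (m : ℕ) (A K : Fin m → Finset ι) (hKA : ∀ l, K l ⊆ A l) (hpriv : ∀ l, ∀ a ∈ A l, a ∉ K l → ∀ l', l' ≠ l → a ∉ A l')
    (hw : ∀ S : Finset (Fin m), S.card = k + 1 → ∃ i ∈ S, ∃ j ∈ S, i ≠ j ∧ K i ⊆ K j) :
    0 ≤ sahiE (bernoulliWeight p) m (fun l => ind {ω : Set ι | ∃ a ∈ A l, a ∈ ω}) :=
  prodBernoulli_sahiE_hit_nonneg_of_core p m A K hKA hpriv fun S _ =>
    prodBernoulli_sahiE_hit_nonneg_of_width_le p hk hC S.card (fun j => K (S.orderEmbOfFin rfl j)) (nested_of_subfamily K hw S)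

end SahiHitting

end Summit.CriticalPhenomena.PercolationContinuityZ3.Theorems

end
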